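import Summits.AtomisticToContinuum.Crystallization.Theorems.ExcessDecayLiouvilleNonlinearCaccioppoliPair
import Summits.AtomisticToContinuum.Crystallization.Theorems.ExcessDecayLiouvilleLinearMassForm

/-!
# Route `ExcessDecayLiouville`: the nonlinear Caccioppoli inequality between two radii, iterable form (nonlinear Caccioppoli, III)

Harmonic-replacement architecture for item `ExcessDecay` (stmt-AtomisticToContinuum-9334), nonlinear half.
`nonlinear_caccioppoli_pair` is specialised to the radial Lipschitz site cut-off between the radii `s < t`
(gap `t − s ≥ 120`; `η = 1` on `B_{s+2}`, scale `d = (t−s)/4`, support radius `R = s + 2 + d`, near/far split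
`L = (t − R − 20)/10` so that the larger ball is exactly `B_t`), and every junk term is expressed in the
currencies of the iteration: the finite nearest-neighbour form `Z(ρ) = NN[f, c₀, ρ]`, the local mass
`𝐌[f, 2b]`, the finite mass `Σ_{SR ∩ B_b} ‖f‖²`, the forcing work `Σ_{SR ∩ B_b} ‖φ‖‖f‖`, the weighted far mass
`𝐉[f, a₀]` and the far flux data `Θ₀/L⁵ + Θ₁` (`caccioppoli_step`):

`Z(s) ≤ θ' Z(t) + A₂/(t−s)² + A₅/(t−s)⁵ + B₀`,  `θ' = 2(4·10⁶Λ)²/κ²`.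

All `[folklore]`; helper lemmas, nothing here closes an item.
-/

noncomputable section

namespace Summit.AtomisticToContinuum.Crystallization.Theorems.ExcessDecayLiouville

open scoped BigOperators Topology InnerProductSpace RealInnerProductSpace Classical
open Literature.MathematicalPhysics.StatisticalMechanics
open Summit.AtomisticToContinuum.Crystallization.Theorems.PhononStabilityNegative

-- Local notation: the force-constant map `K(e)w = h(|e|²)w + 2⟪e,w⟫h′(|e|²)e`.
local notation3 "𝕂[" e "] " w:max =>
  (-((‖e‖ ^ 2)⁻¹) ^ 7 + ((‖e‖ ^ 2)⁻¹) ^ 4) • w + (2 * ⟪e, w⟫ * (7 * ((‖e‖ ^ 2)⁻¹) ^ 8 - 4 * ((‖e‖ ^ 2)⁻¹) ^ 5)) • e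
set_option quotPrecheck false in
-- Local notation: ball indicator.
local notation "𝟙ᵇ[" x ", " c ", " R "]" => (if dist (x : EuclideanSpace ℝ (Fin 3)) c ≤ R then (1 : ℝ) else 0)
set_option quotPrecheck false in
-- Local notation: far kernel.
local notation "𝔣[" ρ ", " p ", " q "]" =>
  (if ρ < dist (p : EuclideanSpace ℝ (Fin 3)) q then (dist (p : EuclideanSpace ℝ (Fin 3)) q)⁻¹ ^ 8 else (0 : ℝ))

section

variable {t : Fin 2 → (EuclideanSpace ℝ (Fin 3))} {A : (EuclideanSpace ℝ (Fin 3)) →L[ℝ] (EuclideanSpace ℝ (Fin 3))}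
  {κ : ℝ} {c₀ : EuclideanSpace ℝ (Fin 3)}

variable (hA : Adm₀ A) (hI : Inner₀ t A)

set_option quotPrecheck false in
-- Local notation: the operator row `(L v)(p)`.
local notation "𝕃" v:max " @ " p:max =>
  tsum (fun q : Sites₀ t A => (if ((p : Sites₀ t A) : EuclideanSpace ℝ (Fin 3)) ≠ q then
    𝕂[((p : Sites₀ t A) : EuclideanSpace ℝ (Fin 3)) - q] (v ((p : Sites₀ t A) : EuclideanSpace ℝ (Fin 3)) - v q) else 0))
set_option quotPrecheck false in
-- Local notation: the finite near-neighbour form on the ball of radius `X` about `c₀`.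
local notation "NN[" v ", " X "]" =>
  (∑ p ∈ (finite_sites_dist_le (t := t) (A := A) hA hI c₀ X).toFinset,
    ∑ q ∈ (finite_sites_dist_le (t := t) (A := A) hA hI c₀ X).toFinset,
      (if p ≠ q ∧ dist p q ≤ 11 / 10 then ‖v p - v q‖ ^ 2 else (0 : ℝ)))
set_option quotPrecheck false in
-- local mass on the ball of radius `X` about `c₀`
local notation "𝐌[" f ", " X "]" =>
  tsum (fun p : Sites₀ t A => ‖f (p : EuclideanSpace ℝ (Fin 3))‖ ^ 2 * 𝟙ᵇ[p, c₀, X])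
set_option quotPrecheck false in
-- weighted far mass with floor `Y` about `c₀`
local notation "𝐉[" f ", " Y "]" =>
  tsum (fun q : Sites₀ t A => ‖f (q : EuclideanSpace ℝ (Fin 3))‖ ^ 2 * (max (dist (q : EuclideanSpace ℝ (Fin 3)) c₀) Y)⁻¹ ^ 8)

/-! ## The finite near-neighbour form: congruence and monotonicity -/

include hA hI in
/-- `NN` only sees the values on the ball. [folklore] -/
theorem NN_congr {v v' : (EuclideanSpace ℝ (Fin 3)) → (EuclideanSpace ℝ (Fin 3))} {X : ℝ}
    (h : ∀ x ∈ Sites₀ t A, dist x c₀ ≤ X → v x = v' x) : NN[v, X] = NN[v', X] := by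
  refine Finset.sum_congr rfl fun p hp => Finset.sum_congr rfl fun q hq => ?_
  obtain ⟨hpS, hpX⟩ := (Set.Finite.mem_toFinset _).1 hp
  obtain ⟨hqS, hqX⟩ := (Set.Finite.mem_toFinset _).1 hq
  rw [h p hpS hpX, h q hqS hqX]

include hA hI in
/-- `NN` is monotone in the radius. [folklore] -/
theorem NN_mono (v : (EuclideanSpace ℝ (Fin 3)) → (EuclideanSpace ℝ (Fin 3))) {X X' : ℝ} (hX : X ≤ X') :
    NN[v, X] ≤ NN[v, X'] := by
  have hsub : (finite_sites_dist_le (t := t) (A := A) hA hI c₀ X).toFinset ⊆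
      (finite_sites_dist_le (t := t) (A := A) hA hI c₀ X').toFinset := by
    intro x hx
    obtain ⟨hxS, hxX⟩ := (Set.Finite.mem_toFinset _).1 hx
    exact (Set.Finite.mem_toFinset _).2 ⟨hxS, hxX.trans hX⟩
  refine le_trans (Finset.sum_le_sum fun p _ => Finset.sum_le_sum_of_subset_of_nonneg hsub fun q _ _ => by positivity)
    (Finset.sum_le_sum_of_subset_of_nonneg hsub fun p _ _ => Finset.sum_nonneg fun q _ => by positivity)

include hA hI in
/-- `NN` is nonnegative. [folklore] -/
theorem NN_nonneg (v : (EuclideanSpace ℝ (Fin 3)) → (EuclideanSpace ℝ (Fin 3))) (X : ℝ) : 0 ≤ NN[v, X] :=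
  Finset.sum_nonneg fun p _ => Finset.sum_nonneg fun q _ => by positivity

include hA hI in
/-- **The cut-off sees the inner ball exactly**: if `η = 1` on the sites of `B_{s+2}(c₀)`, then
`NN[f, s] ≤ nnForm(η f)`. [folklore] -/
theorem NN_le_nnForm_cutoff {f : (EuclideanSpace ℝ (Fin 3)) → (EuclideanSpace ℝ (Fin 3))} {η : (EuclideanSpace ℝ (Fin 3)) → ℝ}
    (hηf : (Function.support fun x => η x • f x).Finite) {s : ℝ}
    (hη1 : ∀ x ∈ Sites₀ t A, dist x c₀ ≤ s + 2 → η x = 1) :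
    NN[f, s] ≤ nnForm t A (fun x => η x • f x) := by
  have h1 : NN[f, s] = NN[(fun x => η x • f x), s] :=
    NN_congr hA hI fun x hx hxs => by rw [hη1 x hx (by linarith), one_smul]
  rw [h1]
  exact NN_le_nnForm hA hI hηf c₀ s

/-! ## The step between two radii -/

omit hA hI in
/-- Scalar bound for the far flux bracket: `(3F₈√E_R + √F₈√Θ)√W ≤ (7/2) F₈' E + Θ'/2` when
`F₈ ≤ F₈'`, `E_R, W ≤ E`, `Θ ≤ Θ'`. [folklore] -/
theorem far_bracket_le {F8 F8' ER W ESR Th Th' : ℝ} (hF8le : F8 ≤ F8') (hF80 : 0 ≤ F8) (hER : ER ≤ ESR)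
    (hW : W ≤ ESR) (hTh : Th ≤ Th') (hTh0 : 0 ≤ Th) (hER0 : 0 ≤ ER) :
    (3 * F8 * Real.sqrt ER + Real.sqrt F8 * Real.sqrt Th) * Real.sqrt W ≤ (7 / 2) * F8' * ESR + Th' / 2 := by
  have hESR0 : 0 ≤ ESR := hER0.trans hER
  have hs1 := Real.sqrt_le_sqrt hER
  have hs2 := Real.sqrt_le_sqrt hW
  have hsE := Real.sq_sqrt hESR0
  have hsF := Real.sq_sqrt hF80
  have hsT := Real.sq_sqrt hTh0
  have h1 : (3 * F8 * Real.sqrt ER + Real.sqrt F8 * Real.sqrt Th) * Real.sqrt W ≤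
      (3 * F8 * Real.sqrt ESR + Real.sqrt F8 * Real.sqrt Th) * Real.sqrt ESR :=
    mul_le_mul (by gcongr) hs2 (Real.sqrt_nonneg _) (by positivity)
  refine h1.trans ?_
  have hu : (Real.sqrt F8 * Real.sqrt ESR) ^ 2 = F8 * ESR := by rw [mul_pow, hsF, hsE]
  have h2 : Real.sqrt F8 * Real.sqrt Th * Real.sqrt ESR ≤ (F8 * ESR + Th) / 2 := by
    have h0 := sq_nonneg (Real.sqrt F8 * Real.sqrt ESR - Real.sqrt Th)
    nlinarith [h0, hu, hsT]
  have h3 : F8 * ESR ≤ F8' * ESR := mul_le_mul_of_nonneg_right hF8le hESR0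
  have h4 : (3 * F8 * Real.sqrt ESR + Real.sqrt F8 * Real.sqrt Th) * Real.sqrt ESR =
      3 * F8 * (Real.sqrt ESR) ^ 2 + Real.sqrt F8 * Real.sqrt Th * Real.sqrt ESR := by ring
  rw [h4, hsE]
  linarith [h2, h3, hTh]

omit hA hI in
/-- Scalar bookkeeping of `caccioppoli_step`. [folklore] -/
theorem step_scalar {κ Λ X θc Nv Nt P Pb F J cM ts M2b ESR Θ₀ Θ₁ Jfar b : ℝ} (hκ0 : 0 < κ) (hΛ : 0 ≤ Λ)
    (hts : 120 ≤ ts)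
    (hpair : X ≤ 2 / κ * (P + Λ * F + J) + θc * Nv + cM) (hθc : 0 ≤ θc) (hNv : Nv ≤ Nt)
    (hP : P ≤ Pb)
    (hF : F ≤ (7 / 2) * ((1024 / (23 / 25 : ℝ) ^ 3) * (20 / ts) ^ 5) * ESR + ((Θ₀ * (20 / ts) ^ 5 + Θ₁)) / 2)
    (hJ : J ≤ 19 * (1024 / ((23 / 25 : ℝ) ^ 3 * (23 / 25 : ℝ) ^ 3)) / (ts / 4) ^ 2 * M2b +
      38 * (1024 / ((23 / 25 : ℝ) ^ 3 * (ts / 4) ^ 5)) * M2b + 19 * (8192 * b ^ 3 * Jfar))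
    (hcM : cM ≤ ((11 / 10 : ℝ) ^ 8 / (ts / 4) ^ 2) * ((1024 / ((23 / 25 : ℝ) ^ 3 * (23 / 25 : ℝ) ^ 3)) * M2b)) :
    X ≤ θc * Nt + 2 / κ * (Pb + Λ * Θ₁ / 2 + 19 * 8192 * b ^ 3 * Jfar) +
      (2 / κ * (19 * 16 * (1024 / ((23 / 25 : ℝ) ^ 3 * (23 / 25 : ℝ) ^ 3))) +
        16 * (11 / 10 : ℝ) ^ 8 * (1024 / ((23 / 25 : ℝ) ^ 3 * (23 / 25 : ℝ) ^ 3))) * M2b / ts ^ 2 +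
      (2 / κ * (38 * 4 ^ 5 * (1024 / (23 / 25 : ℝ) ^ 3) * M2b +
        Λ * 20 ^ 5 * ((7 / 2) * (1024 / (23 / 25 : ℝ) ^ 3) * ESR + Θ₀ / 2))) / ts ^ 5 := by
  have hts0 : 0 < ts := by linarith
  have hθN := mul_le_mul_of_nonneg_left hNv hθc
  have h2κ : 0 ≤ 2 / κ := by positivity
  -- rewrite the gap powers
  have e2 : 19 * (1024 / ((23 / 25 : ℝ) ^ 3 * (23 / 25 : ℝ) ^ 3)) / (ts / 4) ^ 2 * M2b =
      19 * 16 * (1024 / ((23 / 25 : ℝ) ^ 3 * (23 / 25 : ℝ) ^ 3)) * M2b / ts ^ 2 := by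
    field_simp; try ring
  have e5 : 38 * (1024 / ((23 / 25 : ℝ) ^ 3 * (ts / 4) ^ 5)) * M2b = 38 * 4 ^ 5 * (1024 / (23 / 25 : ℝ) ^ 3) * M2b / ts ^ 5 := by
    field_simp; try ring
  have ec : ((11 / 10 : ℝ) ^ 8 / (ts / 4) ^ 2) * ((1024 / ((23 / 25 : ℝ) ^ 3 * (23 / 25 : ℝ) ^ 3)) * M2b) =
      16 * (11 / 10 : ℝ) ^ 8 * (1024 / ((23 / 25 : ℝ) ^ 3 * (23 / 25 : ℝ) ^ 3)) * M2b / ts ^ 2 := by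
    field_simp; try ring
  have eF : (7 / 2) * ((1024 / (23 / 25 : ℝ) ^ 3) * (20 / ts) ^ 5) * ESR + ((Θ₀ * (20 / ts) ^ 5 + Θ₁)) / 2 =
      (20 ^ 5 * ((7 / 2) * (1024 / (23 / 25 : ℝ) ^ 3) * ESR + Θ₀ / 2)) / ts ^ 5 + Θ₁ / 2 := by
    field_simp; try ring
  rw [e2, e5] at hJ
  rw [ec] at hcM
  rw [eF] at hF
  have hΛF := mul_le_mul_of_nonneg_left hF hΛ
  have hin : P + Λ * F + J ≤ Pb + (Λ * ((20 ^ 5 * ((7 / 2) * (1024 / (23 / 25 : ℝ) ^ 3) * ESR + Θ₀ / 2)) / ts ^ 5) + Λ * Θ₁ / 2) +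
      (19 * 16 * (1024 / ((23 / 25 : ℝ) ^ 3 * (23 / 25 : ℝ) ^ 3)) * M2b / ts ^ 2 +
        38 * 4 ^ 5 * (1024 / (23 / 25 : ℝ) ^ 3) * M2b / ts ^ 5 + 19 * (8192 * b ^ 3 * Jfar)) := by
    nlinarith [hP, hΛF, hJ]
  have hmul := mul_le_mul_of_nonneg_left hin h2κ
  have key : 2 / κ * (Pb + (Λ * ((20 ^ 5 * ((7 / 2) * (1024 / (23 / 25 : ℝ) ^ 3) * ESR + Θ₀ / 2)) / ts ^ 5) + Λ * Θ₁ / 2) +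
      (19 * 16 * (1024 / ((23 / 25 : ℝ) ^ 3 * (23 / 25 : ℝ) ^ 3)) * M2b / ts ^ 2 +
        38 * 4 ^ 5 * (1024 / (23 / 25 : ℝ) ^ 3) * M2b / ts ^ 5 + 19 * (8192 * b ^ 3 * Jfar))) +
      16 * (11 / 10 : ℝ) ^ 8 * (1024 / ((23 / 25 : ℝ) ^ 3 * (23 / 25 : ℝ) ^ 3)) * M2b / ts ^ 2 =
      2 / κ * (Pb + Λ * Θ₁ / 2 + 19 * 8192 * b ^ 3 * Jfar) +
      (2 / κ * (19 * 16 * (1024 / ((23 / 25 : ℝ) ^ 3 * (23 / 25 : ℝ) ^ 3))) +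
        16 * (11 / 10 : ℝ) ^ 8 * (1024 / ((23 / 25 : ℝ) ^ 3 * (23 / 25 : ℝ) ^ 3))) * M2b / ts ^ 2 +
      (2 / κ * (38 * 4 ^ 5 * (1024 / (23 / 25 : ℝ) ^ 3) * M2b +
        Λ * 20 ^ 5 * ((7 / 2) * (1024 / (23 / 25 : ℝ) ^ 3) * ESR + Θ₀ / 2))) / ts ^ 5 := by
    field_simp; try ring
  linarith [hpair, hmul, hcM, key, hθN]

include hA hI in
/-- **The nonlinear Caccioppoli step between two radii** `s < t` with `t − s ≥ 120` (see the module
docstring for the choice of cut-off, scale and split). [folklore] -/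
theorem caccioppoli_step (hκ0 : 0 < κ)
    (hκ : ∀ v : (EuclideanSpace ℝ (Fin 3)) → (EuclideanSpace ℝ (Fin 3)), (Function.support v).Finite →
      Function.support v ⊆ Sites₀ t A → κ * nnForm t A v ≤ ∑' p : Sites₀ t A, ⟪𝕃 v @ p, v p⟫)
    {f : (EuclideanSpace ℝ (Fin 3)) → (EuclideanSpace ℝ (Fin 3))} (hf : (Function.support f).Finite)
    {Bf : ℝ} (hfB : ∀ x, ‖f x‖ ≤ Bf) {a₀ b : ℝ} (ha₀ : 0 < a₀) (hb : 0 ≤ b)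
    (SR : Finset (EuclideanSpace ℝ (Fin 3))) (hSRS : ∀ x ∈ SR, x ∈ Sites₀ t A)
    (hSRball : ∀ x ∈ Sites₀ t A, dist x c₀ ≤ b → x ∈ SR)
    (φ : (EuclideanSpace ℝ (Fin 3)) → (EuclideanSpace ℝ (Fin 3)))
    (Φ : (EuclideanSpace ℝ (Fin 3)) → (EuclideanSpace ℝ (Fin 3)) → (EuclideanSpace ℝ (Fin 3)))
    (hrow : ∀ p : Sites₀ t A, (p : EuclideanSpace ℝ (Fin 3)) ∈ SR → dist (p : EuclideanSpace ℝ (Fin 3)) c₀ ≤ b →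
      𝕃 f @ p = φ p + ∑ q ∈ SR.erase p, Φ p q)
    (hanti : ∀ p ∈ SR, ∀ q ∈ SR, Φ q p = -Φ p q)
    {vt : (EuclideanSpace ℝ (Fin 3)) → (EuclideanSpace ℝ (Fin 3))} {Λ Θ₀ Θ₁ : ℝ} (hΛ : 0 ≤ Λ) (hΘ₀ : 0 ≤ Θ₀) (hΘ₁ : 0 ≤ Θ₁)
    (hΦ : ∀ p ∈ SR, ∀ q ∈ SR, p ≠ q → ‖Φ p q‖ ≤ Λ * (dist p q)⁻¹ ^ 8 * ‖vt p - vt q‖)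
    (hvt : ∀ x ∈ Sites₀ t A, dist x c₀ ≤ b → vt x = f x)
    (hΘ2 : ∀ R L : ℝ, R ≤ b → 1 ≤ L → ∑ p ∈ SR.filter (fun p => dist p c₀ ≤ R),
      ∑ q ∈ (SR.erase p).filter (fun q => ¬ dist p q ≤ L), (dist p q)⁻¹ ^ 8 * ‖vt q‖ ^ 2 ≤ Θ₀ / L ^ 5 + Θ₁)
    {s t' : ℝ} (ha₀s : a₀ ≤ s) (hst : 120 ≤ t' - s) (htb : t' ≤ b) :
    NN[f, s] ≤ 2 * (4000000 * Λ) ^ 2 / κ ^ 2 * NN[f, t'] +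
      2 / κ * ((∑ x ∈ SR.filter (fun p => dist p c₀ ≤ b), ‖φ x‖ * ‖f x‖) + Λ * Θ₁ / 2 + 19 * 8192 * b ^ 3 * 𝐉[f, a₀]) +
      (2 / κ * (19 * 16 * (1024 / ((23 / 25 : ℝ) ^ 3 * (23 / 25 : ℝ) ^ 3))) +
        16 * (11 / 10 : ℝ) ^ 8 * (1024 / ((23 / 25 : ℝ) ^ 3 * (23 / 25 : ℝ) ^ 3))) * 𝐌[f, 2 * b] / (t' - s) ^ 2 +
      (2 / κ * (38 * 4 ^ 5 * (1024 / (23 / 25 : ℝ) ^ 3) * 𝐌[f, 2 * b] +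
        Λ * 20 ^ 5 * ((7 / 2) * (1024 / (23 / 25 : ℝ) ^ 3) * (∑ x ∈ SR.filter (fun p => dist p c₀ ≤ b), ‖f x‖ ^ 2) + Θ₀ / 2))) /
        (t' - s) ^ 5 := by
  -- radii
  have hs0 : 0 < s := lt_of_lt_of_le ha₀ ha₀s
  obtain ⟨d, hd⟩ : ∃ d : ℝ, d = (t' - s) / 4 := ⟨_, rfl⟩
  have hd1 : 1 ≤ d := by rw [hd]; linarith
  have hd0 : 0 < d := by linarith
  obtain ⟨R, hR⟩ : ∃ R : ℝ, R = s + 2 + d := ⟨_, rfl⟩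
  have hRb : R ≤ b := by rw [hR, hd]; linarith
  have hR1 : 1 ≤ R := by rw [hR]; linarith
  obtain ⟨L, hL⟩ : ∃ L : ℝ, L = (t' - R - 20) / 10 := ⟨_, rfl⟩
  have hL1 : 1 ≤ L := by rw [hL, hR, hd]; linarith
  have hLts : (t' - s) / 20 ≤ L := by rw [hL, hR, hd]; linarith
  have hRL : R + 10 * L + 20 = t' := by rw [hL]; ring
  -- the cut-off
  have hηfin := siteCutoff_support_finite (t := t) (A := A) hA hI c₀ (s + 2) hd0
  have hηS := siteCutoff_support_subset (t := t) (A := A) c₀ (s + 2) d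
  have hη0 := siteCutoff_nonneg (t := t) (A := A) c₀ (s + 2) d
  have hη1 := siteCutoff_le_one (t := t) (A := A) c₀ (s + 2) d
  have hηR : ∀ x : EuclideanSpace ℝ (Fin 3), R < dist x c₀ →
      (fun x : EuclideanSpace ℝ (Fin 3) => (if x ∈ Sites₀ t A then max (min 1 ((s + 2 + d - dist x c₀) / d)) 0 else 0)) x = 0 :=
    fun x hx => siteCutoff_eq_zero_of_le (t := t) (A := A) hd0 (by rw [hR] at hx; exact hx.le)
  have hlip := fun p q : Sites₀ t A => abs_siteCutoff_sub_le (t := t) (A := A) (c := c₀) (r₁ := s + 2) hd0 p q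
  have hηone : ∀ x ∈ Sites₀ t A, dist x c₀ ≤ s + 2 →
      (fun x : EuclideanSpace ℝ (Fin 3) => (if x ∈ Sites₀ t A then max (min 1 ((s + 2 + d - dist x c₀) / d)) 0 else 0)) x = 1 :=
    fun x hx hxs => siteCutoff_eq_one (t := t) (A := A) hd0 hx hxs
  -- the pair inequality
  have hpair := nonlinear_caccioppoli_pair hA hI hκ0 hκ hf hfB
    (η := fun x : EuclideanSpace ℝ (Fin 3) => (if x ∈ Sites₀ t A then max (min 1 ((s + 2 + d - dist x c₀) / d)) 0 else 0))
    hηfin hηS hη0 hη1 hd1 hηR hlip SR hSRS (fun x hx hxR => hSRball x hx (hxR.trans hRb)) φ Φ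
    (fun p hp hpR => hrow p hp (hpR.trans hRb)) hanti hΛ hL1 hΦ (hΘ2 R L hRb hL1) (vt := vt)
  have hNv : NN[vt, R + 10 * L + 20] ≤ NN[f, t'] := by
    rw [hRL, NN_congr hA hI (v := vt) (v' := f) (fun x hx hxt => hvt x hx (hxt.trans htb))]
  have hθc : 0 ≤ 2 * (4000000 * Λ) ^ 2 / κ ^ 2 := by positivity
  -- the left-hand side
  have hηf : (Function.support fun x => (fun x : EuclideanSpace ℝ (Fin 3) =>
      (if x ∈ Sites₀ t A then max (min 1 ((s + 2 + d - dist x c₀) / d)) 0 else 0)) x • f x).Finite :=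
    hf.subset fun x hx => by
      rw [Function.mem_support] at hx ⊢; intro h; exact hx (by rw [h, smul_zero])
  have hZs := NN_le_nnForm_cutoff hA hI hηf hηone
  refine hZs.trans ?_
  have hts0 : 0 < t' - s := by linarith only [hst]
  -- (P) the forcing work
  have hP : ∑ x ∈ SR, ((fun x : EuclideanSpace ℝ (Fin 3) =>
      (if x ∈ Sites₀ t A then max (min 1 ((s + 2 + d - dist x c₀) / d)) 0 else 0)) x) ^ 2 * (‖φ x‖ * ‖f x‖) ≤
      ∑ x ∈ SR.filter (fun p => dist p c₀ ≤ b), ‖φ x‖ * ‖f x‖ := by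
    rw [Finset.sum_filter]
    refine Finset.sum_le_sum fun x _ => ?_
    by_cases hxb : dist x c₀ ≤ b
    · rw [if_pos hxb]
      have h1 : ((fun x : EuclideanSpace ℝ (Fin 3) =>
          (if x ∈ Sites₀ t A then max (min 1 ((s + 2 + d - dist x c₀) / d)) 0 else 0)) x) ^ 2 ≤ 1 := by
        nlinarith only [hη0 x, hη1 x]
      calc _ ≤ 1 * (‖φ x‖ * ‖f x‖) := mul_le_mul_of_nonneg_right h1 (mul_nonneg (norm_nonneg _) (norm_nonneg _))
        _ = _ := one_mul _
    · rw [if_neg hxb, hηR x (lt_of_le_of_lt hRb (not_le.1 hxb))]; simp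
  -- (E) the finite masses
  have hW2 : ∑ x ∈ SR, ‖((fun x : EuclideanSpace ℝ (Fin 3) =>
      (if x ∈ Sites₀ t A then max (min 1 ((s + 2 + d - dist x c₀) / d)) 0 else 0)) x) ^ 2 • f x‖ ^ 2 ≤
      ∑ x ∈ SR.filter (fun p => dist p c₀ ≤ b), ‖f x‖ ^ 2 := by
    rw [Finset.sum_filter]
    refine Finset.sum_le_sum fun x _ => ?_
    by_cases hxb : dist x c₀ ≤ b
    · rw [if_pos hxb, norm_smul, mul_pow, Real.norm_eq_abs, sq_abs]
      have h1 : (((fun x : EuclideanSpace ℝ (Fin 3) =>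
          (if x ∈ Sites₀ t A then max (min 1 ((s + 2 + d - dist x c₀) / d)) 0 else 0)) x) ^ 2) ^ 2 ≤ 1 := by
        have h2 : ((fun x : EuclideanSpace ℝ (Fin 3) =>
          (if x ∈ Sites₀ t A then max (min 1 ((s + 2 + d - dist x c₀) / d)) 0 else 0)) x) ^ 2 ≤ 1 := by
          nlinarith only [hη0 x, hη1 x]
        have h3 : 0 ≤ ((fun x : EuclideanSpace ℝ (Fin 3) =>
          (if x ∈ Sites₀ t A then max (min 1 ((s + 2 + d - dist x c₀) / d)) 0 else 0)) x) ^ 2 := sq_nonneg _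
        nlinarith only [h2, h3]
      calc _ ≤ 1 * ‖f x‖ ^ 2 := mul_le_mul_of_nonneg_right h1 (sq_nonneg _)
        _ = _ := one_mul _
    · rw [if_neg hxb, hηR x (lt_of_le_of_lt hRb (not_le.1 hxb))]; simp
  have hER : ∑ x ∈ SR.filter (fun p => dist p c₀ ≤ R), ‖vt x‖ ^ 2 ≤ ∑ x ∈ SR.filter (fun p => dist p c₀ ≤ b), ‖f x‖ ^ 2 := by
    have hsub : SR.filter (fun p => dist p c₀ ≤ R) ⊆ SR.filter (fun p => dist p c₀ ≤ b) := by
      intro x hx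
      rw [Finset.mem_filter] at hx ⊢
      exact ⟨hx.1, hx.2.trans hRb⟩
    calc _ = ∑ x ∈ SR.filter (fun p => dist p c₀ ≤ R), ‖f x‖ ^ 2 := by
          refine Finset.sum_congr rfl fun x hx => ?_
          rw [Finset.mem_filter] at hx
          rw [hvt x (hSRS x hx.1) (hx.2.trans hRb)]
      _ ≤ _ := Finset.sum_le_sum_of_subset_of_nonneg hsub fun _ _ _ => sq_nonneg _
  -- (F) the far flux bracket
  have hE0 : 0 ≤ ∑ x ∈ SR.filter (fun p => dist p c₀ ≤ R), ‖vt x‖ ^ 2 := Finset.sum_nonneg fun _ _ => sq_nonneg _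
  have hL0 : 0 < L := by linarith only [hL1]
  have hinvL : 1 / L ≤ 20 / (t' - s) := by rw [div_le_div_iff₀ hL0 hts0]; linarith only [hLts]
  have hinvL5 : (1 / L) ^ 5 ≤ (20 / (t' - s)) ^ 5 := pow_le_pow_left₀ (by positivity) hinvL 5
  have hF8le : 1024 / ((23 / 25 : ℝ) ^ 3 * L ^ 5) ≤ (1024 / (23 / 25 : ℝ) ^ 3) * (20 / (t' - s)) ^ 5 := by
    rw [show 1024 / ((23 / 25 : ℝ) ^ 3 * L ^ 5) = (1024 / (23 / 25 : ℝ) ^ 3) * (1 / L) ^ 5 by field_simp]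
    exact mul_le_mul_of_nonneg_left hinvL5 (by positivity)
  have hF80 : 0 ≤ 1024 / ((23 / 25 : ℝ) ^ 3 * L ^ 5) := by positivity
  have hΘ2le : Θ₀ / L ^ 5 + Θ₁ ≤ Θ₀ * (20 / (t' - s)) ^ 5 + Θ₁ := by
    rw [show Θ₀ / L ^ 5 = Θ₀ * (1 / L) ^ 5 by field_simp]
    have := mul_le_mul_of_nonneg_left hinvL5 hΘ₀
    linarith only [this]
  have hΘ20 : 0 ≤ Θ₀ / L ^ 5 + Θ₁ := add_nonneg (div_nonneg hΘ₀ (pow_nonneg hL0.le 5)) hΘ₁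
  have hF := far_bracket_le hF8le hF80 hER hW2 hΘ2le hΘ20 hE0
  -- (J) the cut-off junk
  have hRd : R + d ≤ 2 * b := by rw [hR, hd]; linarith only [hst, htb, hb, hs0]
  have hM1 : 𝐌[f, R + d] ≤ 𝐌[f, 2 * b] := mass_mono hA hI f hRd
  have hM2 : 𝐌[f, R] ≤ 𝐌[f, 2 * b] := mass_mono hA hI f (by linarith only [hRb, hb])
  have hM3 : 𝐌[f, 2 * R] ≤ 𝐌[f, 2 * b] := mass_mono hA hI f (by linarith only [hRb])
  have hM4 : 𝐌[f, R + 0] ≤ 𝐌[f, 2 * b] := mass_mono hA hI f (by linarith only [hRb, hb])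
  have hd23 : 23 / 25 ≤ d := by linarith only [hd1]
  have ha₀R : a₀ ≤ R := by rw [hR]; linarith only [ha₀s, hd0]
  have hTT := tail_le_local_add_far hA hI hf c₀ (R' := R) (ρ' := d) (Y := a₀) hR1 hd23 ha₀ ha₀R
  have hM0 : 0 ≤ 𝐌[f, 2 * b] := mass_nonneg f _
  have hJ0 : 0 ≤ 𝐉[f, a₀] := farMass_nonneg f a₀ ha₀
  have hR3 : R ^ 3 ≤ b ^ 3 := pow_le_pow_left₀ (by linarith only [hR1]) hRb 3
  have hF5 : 0 ≤ 1024 / ((23 / 25 : ℝ) ^ 3 * d ^ 5) := div_nonneg (by norm_num) (mul_nonneg (by norm_num) (pow_nonneg hd0.le 5))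
  have hJ : (19 * (1024 / ((23 / 25 : ℝ) ^ 3 * (23 / 25 : ℝ) ^ 3)) / d ^ 2 * 𝐌[f, R + d] +
      19 * 1 * (1024 / ((23 / 25 : ℝ) ^ 3 * d ^ 5)) * 𝐌[f, R] +
      19 * (1 : ℝ)⁻¹ * (∑' p : Sites₀ t A, ∑' q : Sites₀ t A, (if (p : (EuclideanSpace ℝ (Fin 3))) ≠ q then
        𝔣[d, p, q] * 𝟙ᵇ[p, c₀, R] * ‖f q‖ ^ 2 else 0))) ≤
      19 * (1024 / ((23 / 25 : ℝ) ^ 3 * (23 / 25 : ℝ) ^ 3)) / ((t' - s) / 4) ^ 2 * 𝐌[f, 2 * b] +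
      38 * (1024 / ((23 / 25 : ℝ) ^ 3 * ((t' - s) / 4) ^ 5)) * 𝐌[f, 2 * b] + 19 * (8192 * b ^ 3 * 𝐉[f, a₀]) := by
    rw [← hd]
    have h1 : (19 * (1024 / ((23 / 25 : ℝ) ^ 3 * (23 / 25 : ℝ) ^ 3)) / d ^ 2 * 𝐌[f, R + d]) ≤
        19 * (1024 / ((23 / 25 : ℝ) ^ 3 * (23 / 25 : ℝ) ^ 3)) / d ^ 2 * 𝐌[f, 2 * b] :=
      mul_le_mul_of_nonneg_left hM1 (by positivity)
    have h2 : 19 * 1 * (1024 / ((23 / 25 : ℝ) ^ 3 * d ^ 5)) * 𝐌[f, R] ≤ 19 * (1024 / ((23 / 25 : ℝ) ^ 3 * d ^ 5)) * 𝐌[f, 2 * b] := by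
      rw [mul_one]; exact mul_le_mul_of_nonneg_left hM2 (by positivity)
    have h3 : 19 * (1 : ℝ)⁻¹ * (∑' p : Sites₀ t A, ∑' q : Sites₀ t A, (if (p : (EuclideanSpace ℝ (Fin 3))) ≠ q then
        𝔣[d, p, q] * 𝟙ᵇ[p, c₀, R] * ‖f q‖ ^ 2 else 0)) ≤
        19 * ((1024 / ((23 / 25 : ℝ) ^ 3 * d ^ 5)) * 𝐌[f, 2 * b] + 8192 * b ^ 3 * 𝐉[f, a₀]) := by
      rw [inv_one, mul_one]
      refine mul_le_mul_of_nonneg_left (hTT.trans (add_le_add (mul_le_mul_of_nonneg_left hM3 hF5) ?_)) (by norm_num)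
      exact mul_le_mul_of_nonneg_right (mul_le_mul_of_nonneg_left hR3 (by norm_num)) hJ0
    linarith only [h1, h2, h3]
  have hcM : ((11 / 10 : ℝ) ^ 8 / d ^ 2) * ((1024 / ((23 / 25 : ℝ) ^ 3 * (23 / 25 : ℝ) ^ 3)) * 𝐌[f, R + 0]) ≤
      ((11 / 10 : ℝ) ^ 8 / ((t' - s) / 4) ^ 2) * ((1024 / ((23 / 25 : ℝ) ^ 3 * (23 / 25 : ℝ) ^ 3)) * 𝐌[f, 2 * b]) := by
    rw [← hd]
    exact mul_le_mul_of_nonneg_left (mul_le_mul_of_nonneg_left hM4 (by positivity)) (by positivity)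
  exact step_scalar hκ0 hΛ hst hpair hθc hNv hP hF hJ hcM

end

end Summit.AtomisticToContinuum.Crystallization.Theorems.ExcessDecayLiouville

end
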